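import Mathlib

/-!
# HodgeLocusCensusInert11SpinorBCore — local certificates for THEOREM SG11 (engine B, pub-hlocus-abs-2 gen 33)

certified instances and evidence bearing on the general Hodge conjecture; no claim.

ROW 11 of the V3-XT `N = 1` Hodge-locus census (DERIVATIONS_engineB.md §33): the Gross lattices `S_b^{(k)}`
(`b ∈ {1728, 0}`, depth `k ≥ 0`) of the orders `ℤ[i] + 11^k O₁₇₂₈`, `ℤ[ρ] + 11^k O₀` in `(−1,−11)_ℚ` have reduced
doubled Gram matrices `R1728 C = [[8,0,−4],[0,2C,0],[−4,0,2C+2]]` (`C = 11^{2k+1}`, Inert11BCore `reduce_1728`).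
THEOREM SG11 (§33.9): for every `k` the genus of `S_b^{(k)}` is a SINGLE SPINOR GENUS — by the Conway–Sloane / Watson
algorithm every prime is tractable: at `p = 11` the form is `⟨4⟩ ⊕ 11^{2k+1}⟨1, 1⟩` (a Jordan constituent of dimension 2),
at `p = 2` it is `⟨C⟩ ⊕ 2·[[2,−1],[−1,(C+1)/2]]` with `(C+1)/2` even (a type-II summand, list (II) = `{4u₁,4u₃,4u₅,4u₇}`).
Consequently no difference of theta series inside the genus has a unary component (contrast: ROW 7, where `7` is
intractable — HalfLawBCore `loc7`).  This file certifies the two local shapes for every `C`, and the parity facts for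
`C = 11^{2k+1}`, by `ring` / `decide` only.  Nothing here is cited as a published fact.
-/

set_option linter.dupNamespace false

namespace Summit.HodgeConjecture.HodgeConjecture.HodgeLocus.Census.Inert11SpinorBCore

open Matrix

/-- reduced doubled Gram matrix of `S₁₇₂₈^{(k)}` (`C = 11^{2k+1}`), as in Inert11BCore. -/
def R1728 (C : ℤ) : Matrix (Fin 3) (Fin 3) ℤ := !![8, 0, -4; 0, 2*C, 0; -4, 0, 2*C + 2]

/-- `2·V` with `V = [[1,0,0],[0,1,0],[½,0,1]]` (determinant `1`, entries in `ℤ[½] ⊂ ℤ₁₁`). -/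
def V2 : Matrix (Fin 3) (Fin 3) ℤ := !![2, 0, 0; 0, 2, 0; 1, 0, 2]

/-- `det (2V) = 8`, a unit at every odd prime. -/
theorem V2_det : V2.det = 8 := by decide

/-- 11-ADIC SHAPE: `(2V)·R1728(C)·(2V)ᵀ = diag(32, 8C, 8C) = 8·diag(4, C, C)`, i.e. over `ℤ_p` (`p` odd) the halved form is
`⟨4⟩ ⊕ C·⟨1, 1⟩`; for `C = 11^{2k+1}` the `11^{2k+1}`-modular Jordan constituent has dimension 2, so by the
Conway–Sloane rule (i) every 11-adic unit is automorphous: `11` is tractable. -/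
theorem loc_odd (C : ℤ) : V2 * R1728 C * V2ᵀ = !![32, 0, 0; 0, 8*C, 0; 0, 0, 8*C] := by
  ext i j; fin_cases i <;> fin_cases j <;>
    simp [V2, R1728, Matrix.mul_apply, Fin.sum_univ_three, Matrix.transpose_apply] <;> ring

/-- unimodular reordering of the basis exhibiting the 2-adic splitting `⟨2C⟩ ⊕ [[8,−4],[−4,2C+2]]` (doubled), i.e. halved
`⟨C⟩ ⊕ 2·[[2,−1],[−1,(C+1)/2]]`. -/
def P2 : Matrix (Fin 3) (Fin 3) ℤ := !![0, 1, 0; 1, 0, 0; 0, 0, 1]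

/-- `P2` is unimodular. -/
theorem P2_det : P2.det = -1 := by decide

/-- 2-ADIC SHAPE: `P2·R1728(C)·P2ᵀ = [[2C,0,0],[0,8,−4],[0,−4,2C+2]]`. -/
theorem loc_two (C : ℤ) : P2 * R1728 C * P2ᵀ = !![2*C, 0, 0; 0, 8, -4; 0, -4, 2*C + 2] := by
  ext i j; fin_cases i <;> fin_cases j <;>
    simp [P2, R1728, Matrix.mul_apply, Fin.sum_univ_three, Matrix.transpose_apply]

/-- the binary block `[[8,−4],[−4,2C+2]] = 2·2·[[2,−1],[−1,(C+1)/2]]` is of Conway–Sloane type II with `q = 2` exactly when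
`a = 2` and `c = (C+1)/2` are even, `b = −1` is odd and `ac − b² = C` is odd: for `C = 11^{2k+1}`, `C ≡ 3 (mod 8)`
(so `(C+1)/2 ≡ 2 (mod 4)` is even and `C` is odd, and `⟨C⟩ = ⟨u₃⟩`).  Checked for `k ≤ 5`; in general
`11² ≡ 1 (mod 8)` gives `11^{2k+1} ≡ 3 (mod 8)`. -/
theorem eleven_odd_powers_mod8 : ∀ k ∈ List.range 6, (11 : ℤ) ^ (2 * k + 1) % 8 = 3 := by decide

/-- `11^{2k+1} ≡ 3 (mod 8)` for every `k`. -/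
theorem eleven_odd_power_mod8 (k : ℕ) : (11 : ℤ) ^ (2 * k + 1) % 8 = 3 := by
  induction k with
  | zero => norm_num
  | succ n ih =>
    have h : (11 : ℤ) ^ (2 * (n + 1) + 1) = 121 * 11 ^ (2 * n + 1) := by ring
    rw [h]; omega

/-- the depth-0 and depth-1 instances used in §33.9: `C = 11` and `C = 1331`; list (I) at `2` is `{C} = {u₃}`
(`C ≡ 3 mod 8`), list (II) is `{4u₁, 4u₃, 4u₅, 4u₇}`; at `11` the diagonal is `{4, C, C}`. -/
theorem instances : (11 : ℤ) % 8 = 3 ∧ (1331 : ℤ) % 8 = 3 ∧ (1331 : ℤ) = 11 ^ 3 ∧ ((1331 : ℤ) + 1) / 2 % 2 = 0 ∧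
    ((11 : ℤ) + 1) / 2 % 2 = 0 := by decide

end Summit.HodgeConjecture.HodgeConjecture.HodgeLocus.Census.Inert11SpinorBCore
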